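import Summits.QuantumFields.YangMills.Theorems.FluctuationComparisonRegPrIntLS2BetaPosCollarOfLocalGrowth
import Summits.QuantumFields.YangMills.Theorems.UnitScaleTiltProp7CritEL
import HarnessLib

/-!
# S2β · POS∘ — THE TAYLOR HALF (T6): POS∘ ∕ TUBE♭ FROM ORBIT-`dist1²` GROWTH OVER THE REGULAR COMPETITORS (px17 g15's pen-3 shape, RESIDUAL edition)

Cell `ym3-torus` (YM ladder rung R3 = continuum `SU(2)` Yang–Mills on the three-torus at fixed lattice data — a RUNG: NOT d = 4, NOT infinite volume,
NOT a mass gap, NOT Clay).  Width seat `ym3-torus-px21` (gen 18); the (T)-chain (✓(T1)…✓(T5)).  Crux `stmt-QuantumFields-20520` (`…Theses.UnitScaleTilt.FluctuationComparisonRegPrIntL`),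
LINE g18-1 S2β; `--kind proof --supports stmt-QuantumFields-20520 --as helper`, count-neutral, DEFINITION-FREE (0 `def`, 0 `instance`, 0 `notation`, 0 `sorry`, default heartbeats).

WHY.  px17 g15's pen 3 `…S2BetaOrbitGrowthOfRegular.orbitGrowth_of_regular_five ∕ _of_isCritR2_five` ([Balaban1985Variational] (142) with its K-uniform rate, zero hypotheses at
`L ≥ 5`) concludes, for every regular competitor `W′ ∈ regFibrePr e V` of the base point `W`: `∃ u, c·ℓ⁻²·Σ_ℓ dist1 (W′ ℓ·((u•W) ℓ)⁻¹)² ≤ A W′ − A W`.  The (T)-chain's collar letter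
POS∘ (px8's `hpos`) measures distance to the RESIDUAL orbit (`⨅` over descent-preserving `w`).  THIS FILE is the dock for the RESIDUAL edition of that growth shape — the one extra token
the consumer needs (`u` descent-preserving; pen 3's `u` comes from the (1.29)-restricted chart transformation, whose residual-ness is residue (a) of px17's list):
* ★★★ `posCollar_of_orbitGrowth_residual` — POS∘ ⟸ {orbit growth over the regular competitors with a RESIDUAL `u`, `U₀ ∈ regFibrePr e V` with `A U₀ = minActionRegPr ε₀ V`,
  `descendTo` continuous near `U₀` ((T2d))}: near-orbit points of the closed good fibre are regular competitors (✓`Prop7CritEL.isOpen_regPr` + ✓(T2b) `mem_fibre_of_mem_closure_of_continuousAt`),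
  then ✓(T4) §1 `posCollar_of_growthOn_nhds`;
* ★★★ `tubeGrowth_of_orbitGrowth_residual_of_isolated` — TUBE♭(V,U₀) ⟸ {the same, ISOL∘(δ)} (✓px8 door).

HONEST: a dock; the residual-`u` growth letter and ISOL∘(δ) are DISPLAYED; TUBE-REG∘ (datum-free δ, K-uniform μ in the organ's quantifier order), GAP♯∘, GAP♭, EXW∘, S2β, crux 20520 NOT
proved; no summit statement is proved by a helper; finite-volume ∕ conditional; rung R3 = SU(2) YM₃ on T³ — NOT d = 4, NOT infinite volume, NOT a mass gap, NOT Clay; the Yang–Mills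
mass gap is NOT proved.  Sorry-free, axioms standard.

References: T. Bałaban, CMP **102** (1985) 277–309 [Balaban1985Variational] (Thm 1 (8)–(10) p.279, (141)–(143) p.299); CMP **102** (1985) 255–275 [Balaban1985UV3] ((12)–(13) p.259,
(18)–(22) p.260); CMP **99** (1985) 75–102 [Balaban1985RegularSpaces] (Thm 2 p.83).
-/

set_option autoImplicit false

noncomputable section

namespace Summit.QuantumFields.YangMills.Theorems.FluctuationComparisonRegPrIntLS2BetaPosCollarOfOrbitGrowth

open Set Filter Topology Function
open scoped Matrix.Norms.L2Operator
open Literature.MathematicalPhysics.QuantumFieldTheory.Balaban1983to89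
open Literature.MathematicalPhysics.QuantumFieldTheory.Balaban1983to89.T3ContinuumYM3Torus
open Literature.MathematicalPhysics.QuantumFieldTheory.Balaban1983to89.T3UnitLawDensityEML (ℰp)
open Literature.MathematicalPhysics.QuantumFieldTheory.Balaban1983to89.T3UnitScaleTilt
open Literature.MathematicalPhysics.QuantumFieldTheory.Balaban1983to89.T3TiltDescent
open Literature.MathematicalPhysics.QuantumFieldTheory.Balaban1983to89.T3ConstrainedMinimiser (fibre)
open Literature.MathematicalPhysics.QuantumFieldTheory.Balaban1983to89.T3PrintedRegularMinimiser
open Literature.MathematicalPhysics.QuantumFieldTheory.Balaban1983to89.T4Continuum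
open scoped Literature.MathematicalPhysics.QuantumFieldTheory.Balaban1983to89.T3OrbitAverage
open Summit.QuantumFields.YangMills.Theorems.FluctuationComparisonRegPrIntLS2BetaResidualGauge
open Summit.QuantumFields.YangMills.Theorems.FluctuationComparisonRegPrIntLS2BetaPosCollarCoverOfTubeChart (mem_fibre_of_mem_closure_of_continuousAt)
open Summit.QuantumFields.YangMills.Theorems.FluctuationComparisonRegPrIntLS2BetaPosCollarOfLocalGrowth
open Summit.QuantumFields.YangMills.Theorems.FluctuationComparisonRegPrIntLS2BetaTubeGrowthOfIsolated (tubeGrowth_of_pos_of_isolated)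
open Summit.QuantumFields.YangMills.Theorems.Prop7CritEL (isOpen_regPr)

variable (F : T3Family) {J K : ℕ} (hJK : J ≤ K)
variable {γ b₀ p₀ ε₀ e : ℝ}

/-- ★★★ **POS∘ ⟸ ORBIT-`dist1²` GROWTH OVER THE REGULAR COMPETITORS, RESIDUAL EDITION.**  Base point `U₀ ∈ regFibrePr e V` realising `minActionRegPr ε₀ V`; `descendTo` continuous near `U₀`;
growth letter: every `W′ ∈ regFibrePr e V` has a DESCENT-PRESERVING `u` with `c·Σ_ℓ dist1 (W′ ℓ·((u•U₀) ℓ)⁻¹)² ≤ A W′ − A U₀` (`c > 0`; read `c := c′·(L^{K−J})⁻²` for pen 3's rate).  Then px8's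
POS∘ letter (`hpos` of ✓`tubeGrowth_of_pos_of_isolated`) holds with the same `c`. [cite: Balaban1985Variational, (141)-(143) p.299; Balaban1985UV3, (12)-(13) p.259] -/
theorem posCollar_of_orbitGrowth_residual
    (V : GaugeField (F.P J) 0 (Matrix.specialUnitaryGroup (Fin 2) ℂ)) (U₀ : GaugeField (F.P K) 0 (Matrix.specialUnitaryGroup (Fin 2) ℂ)) (δ : ℝ)
    (hU₀reg : U₀ ∈ regFibrePr F J K hJK e V) (hmin : wilsonAction4 U₀ = minActionRegPr F J K hJK ε₀ V)
    (hcont : ∀ᶠ W in 𝓝 U₀, ContinuousAt (descendTo F ℰp J K hJK) W) {c : ℝ} (hc : 0 < c)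
    (hgrowth : ∀ W' ∈ regFibrePr F J K hJK e V, ∃ u : Site (F.P K) 0 → Matrix.specialUnitaryGroup (Fin 2) ℂ,
      (∀ U'' : GaugeField (F.P K) 0 (Matrix.specialUnitaryGroup (Fin 2) ℂ),
          descendTo F ℰp J K hJK (GaugeField.gaugeAct u U'') = descendTo F ℰp J K hJK U'') ∧
        c * (∑ ℓ : PBond (F.P K) 0, dist1 (W' ℓ * ((GaugeField.gaugeAct u U₀) ℓ)⁻¹) ^ 2) ≤ wilsonAction4 W' - wilsonAction4 U₀) :
    ∃ r c : ℝ, 0 < r ∧ 0 < c ∧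
      ∀ U ∈ closure (fibre F ℰp J K hJK V ∩ histGood F ℰp (θBal F.L γ b₀ p₀) K J),
        (∃ w : Site (F.P K) 0 → Matrix.specialUnitaryGroup (Fin 2) ℂ,
          (∀ U'' : GaugeField (F.P K) 0 (Matrix.specialUnitaryGroup (Fin 2) ℂ),
              descendTo F ℰp J K hJK (GaugeField.gaugeAct w U'') = descendTo F ℰp J K hJK U'') ∧
            ∀ ℓ : PBond (F.P K) 0, dist1 (U ℓ * ((GaugeField.gaugeAct w U₀) ℓ)⁻¹) ≤ δ) →
        (⨅ w : {w : Site (F.P K) 0 → Matrix.specialUnitaryGroup (Fin 2) ℂ |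
            ∀ U : GaugeField (F.P K) 0 (Matrix.specialUnitaryGroup (Fin 2) ℂ),
              descendTo F ℰp J K hJK (GaugeField.gaugeAct w U) = descendTo F ℰp J K hJK U},
          ∑ ℓ : PBond (F.P K) 0,
            dist1 (U ℓ * ((GaugeField.gaugeAct (w : Site (F.P K) 0 → Matrix.specialUnitaryGroup (Fin 2) ℂ) U₀) ℓ)⁻¹) ^ 2) ≤ r →
        c * (⨅ w : {w : Site (F.P K) 0 → Matrix.specialUnitaryGroup (Fin 2) ℂ |
            ∀ U : GaugeField (F.P K) 0 (Matrix.specialUnitaryGroup (Fin 2) ℂ),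
              descendTo F ℰp J K hJK (GaugeField.gaugeAct w U) = descendTo F ℰp J K hJK U},
          ∑ ℓ : PBond (F.P K) 0,
            dist1 (U ℓ * ((GaugeField.gaugeAct (w : Site (F.P K) 0 → Matrix.specialUnitaryGroup (Fin 2) ℂ) U₀) ℓ)⁻¹) ^ 2)
          ≤ wilsonAction4 U - minActionRegPr F J K hJK ε₀ V := by
  -- the neighbourhood: print's regular class (open) ∩ the continuity set of the descent
  have hreg0 : U₀ ∈ {U : GaugeField (F.P K) 0 (Matrix.specialUnitaryGroup (Fin 2) ℂ) | RegPr F J K e U} := ((mem_regFibrePr_iff F).1 hU₀reg).2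
  have hN : ({U : GaugeField (F.P K) 0 (Matrix.specialUnitaryGroup (Fin 2) ℂ) | RegPr F J K e U} ∩
      {W | ContinuousAt (descendTo F ℰp J K hJK) W}) ∈ 𝓝 U₀ := inter_mem ((isOpen_regPr F J K e).mem_nhds hreg0) hcont
  refine posCollar_of_growthOn_nhds F hJK V U₀ δ hN hc fun U hU hUN => ?_
  -- a near point of the closed good fibre is a regular competitor
  have hUf : U ∈ fibre F ℰp J K hJK V := mem_fibre_of_mem_closure_of_continuousAt F hJK (closure_mono inter_subset_left hU) hUN.2
  have hUreg : U ∈ regFibrePr F J K hJK e V := (mem_regFibrePr_iff F).2 ⟨hUf, hUN.1⟩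
  obtain ⟨u, hu, hgrow⟩ := hgrowth U hUreg
  -- the residual-orbit distance is at most the `u`-term
  have hbdd : BddBelow (Set.range fun w' : {w : Site (F.P K) 0 → Matrix.specialUnitaryGroup (Fin 2) ℂ |
      ∀ U : GaugeField (F.P K) 0 (Matrix.specialUnitaryGroup (Fin 2) ℂ),
        descendTo F ℰp J K hJK (GaugeField.gaugeAct w U) = descendTo F ℰp J K hJK U} =>
      ∑ ℓ : PBond (F.P K) 0,
        dist1 (U ℓ * ((GaugeField.gaugeAct (w' : Site (F.P K) 0 → Matrix.specialUnitaryGroup (Fin 2) ℂ) U₀) ℓ)⁻¹) ^ 2) :=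
    ⟨0, by rintro _ ⟨w', rfl⟩; exact Finset.sum_nonneg fun ℓ _ => sq_nonneg _⟩
  have hle := ciInf_le hbdd ⟨u, hu⟩
  rw [← hmin]
  exact (mul_le_mul_of_nonneg_left hle hc.le).trans hgrow

/-- ★★★ **TUBE♭(V,U₀) ⟸ {ORBIT GROWTH OVER THE REGULAR COMPETITORS (RESIDUAL `u`), ISOL∘(δ)}** — ✓px8 `tubeGrowth_of_pos_of_isolated` ∘ `posCollar_of_orbitGrowth_residual`.
[cite: Balaban1985Variational, (141)-(143) p.299; Balaban1985UV3, (12)-(13) p.259 and (18)-(22) p.260] -/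
theorem tubeGrowth_of_orbitGrowth_residual_of_isolated
    (V : GaugeField (F.P J) 0 (Matrix.specialUnitaryGroup (Fin 2) ℂ)) (U₀ : GaugeField (F.P K) 0 (Matrix.specialUnitaryGroup (Fin 2) ℂ)) (δ : ℝ)
    (hU₀reg : U₀ ∈ regFibrePr F J K hJK e V) (hmin : wilsonAction4 U₀ = minActionRegPr F J K hJK ε₀ V)
    (hcont : ∀ᶠ W in 𝓝 U₀, ContinuousAt (descendTo F ℰp J K hJK) W) {c : ℝ} (hc : 0 < c)
    (hgrowth : ∀ W' ∈ regFibrePr F J K hJK e V, ∃ u : Site (F.P K) 0 → Matrix.specialUnitaryGroup (Fin 2) ℂ,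
      (∀ U'' : GaugeField (F.P K) 0 (Matrix.specialUnitaryGroup (Fin 2) ℂ),
          descendTo F ℰp J K hJK (GaugeField.gaugeAct u U'') = descendTo F ℰp J K hJK U'') ∧
        c * (∑ ℓ : PBond (F.P K) 0, dist1 (W' ℓ * ((GaugeField.gaugeAct u U₀) ℓ)⁻¹) ^ 2) ≤ wilsonAction4 W' - wilsonAction4 U₀)
    (hisol : ∀ U ∈ closure (fibre F ℰp J K hJK V ∩ histGood F ℰp (θBal F.L γ b₀ p₀) K J),
        (∃ w : Site (F.P K) 0 → Matrix.specialUnitaryGroup (Fin 2) ℂ,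
          (∀ U'' : GaugeField (F.P K) 0 (Matrix.specialUnitaryGroup (Fin 2) ℂ),
              descendTo F ℰp J K hJK (GaugeField.gaugeAct w U'') = descendTo F ℰp J K hJK U'') ∧
            ∀ ℓ : PBond (F.P K) 0, dist1 (U ℓ * ((GaugeField.gaugeAct w U₀) ℓ)⁻¹) ≤ δ) →
        wilsonAction4 U ≤ minActionRegPr F J K hJK ε₀ V →
        (⨅ w : {w : Site (F.P K) 0 → Matrix.specialUnitaryGroup (Fin 2) ℂ |
            ∀ U : GaugeField (F.P K) 0 (Matrix.specialUnitaryGroup (Fin 2) ℂ),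
              descendTo F ℰp J K hJK (GaugeField.gaugeAct w U) = descendTo F ℰp J K hJK U},
          ∑ ℓ : PBond (F.P K) 0,
            dist1 (U ℓ * ((GaugeField.gaugeAct (w : Site (F.P K) 0 → Matrix.specialUnitaryGroup (Fin 2) ℂ) U₀) ℓ)⁻¹) ^ 2) = 0) :
    ∃ μ : ℝ, 0 < μ ∧ ∀ U ∈ fibre F ℰp J K hJK V, U ∈ histGood F ℰp (θBal F.L γ b₀ p₀) K J →
      (∃ w : Site (F.P K) 0 → Matrix.specialUnitaryGroup (Fin 2) ℂ,
        (∀ U'' : GaugeField (F.P K) 0 (Matrix.specialUnitaryGroup (Fin 2) ℂ),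
            descendTo F ℰp J K hJK (GaugeField.gaugeAct w U'') = descendTo F ℰp J K hJK U'') ∧
          ∀ ℓ : PBond (F.P K) 0, dist1 (U ℓ * ((GaugeField.gaugeAct w U₀) ℓ)⁻¹) ≤ δ) →
      μ * ((F.L : ℝ)⁻¹) ^ (2 * (K - J)) *
          (⨅ w : {w : Site (F.P K) 0 → Matrix.specialUnitaryGroup (Fin 2) ℂ |
              ∀ U : GaugeField (F.P K) 0 (Matrix.specialUnitaryGroup (Fin 2) ℂ),
                descendTo F ℰp J K hJK (GaugeField.gaugeAct w U) = descendTo F ℰp J K hJK U},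
            ∑ ℓ : PBond (F.P K) 0,
              dist1 (U ℓ * ((GaugeField.gaugeAct (w : Site (F.P K) 0 → Matrix.specialUnitaryGroup (Fin 2) ℂ) U₀) ℓ)⁻¹) ^ 2)
        ≤ wilsonAction4 U - minActionRegPr F J K hJK ε₀ V :=
  tubeGrowth_of_pos_of_isolated F hJK V U₀ δ (posCollar_of_orbitGrowth_residual F hJK V U₀ δ hU₀reg hmin hcont hc hgrowth) hisol

end Summit.QuantumFields.YangMills.Theorems.FluctuationComparisonRegPrIntLS2BetaPosCollarOfOrbitGrowth

end
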